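import Summits.Ventures.LatticeQCDFlow.Scaling.IdealStarMixingCeiling
import Summits.Ventures.LatticeQCDFlow.Scaling.LazyHubWindow
import Literature.Probability.MarkovChains.LazyChainSuccessiveDistance

/-!
HONEST FRAMING: exact (Metropolis-corrected) sampling algorithms for lattice gauge theory; figures
of merit are autocorrelation/cost numbers at stated couplings and volumes; no continuum-physics
claim.

# LazyIdealStarCeiling — THE LAZY IDEALISED STAR OBEYS THE `K·log K` LAW ON BOTH SIDES:
# `(2K/t − 1)·log(K/4) ≤ t_mix^{lazy}(1/4) ≤ ⌈(4m/(t(1−t)c))·log(4(K+1)/t)⌉`, CLOSING THE WINDOW OF `Scaling/LazyHubWindow`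
# IN THE IDEALISED CASE (lean-2 GEN-24, ours)

Venture-side (OURS).  Cell `lqcd-flow` (pub-lqcd), unit `pub-lqcd-lean-2-g24`, 2026-08-27.  Chapter L (the coupon-collector
law from a cold start), file 21.  `Scaling/LazyHubWindow` set the lazy collector floor `(2K/θ_Σ − 1)·log(K/4)` against the
only ceiling then available, the spectral one of K6 (`∝ K²·log(1/m₀^{K+1})`), leaving a window of two orders.  For the
idealised hot-only hub (`Scaling/IdealStarMixingCeiling`: all levels share one law `ν`, identity maps, exact hot sampler)
the window closes: the lazy chain at time `n` is the binomial mixture `Σ_j C(n,j)2⁻ⁿ·(δ_x Pʲ)` of the plain chain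
(Levin–Peres–Wilmer (5.7), `Literature/…/LazyChainSuccessiveDistance`), total variation is convex, and the plain ceiling
`d(j) ≤ (K+1)λʲ/t` (`λ = 1 − t(1−t)c/(2m)`) sums to `d^{lazy}(n) ≤ (K+1)((1+λ)/2)ⁿ/t` by the binomial theorem — laziness
costs exactly a factor two in the rate, matching the factor two in the lazy floor.

## What is proved

* §1 **`tvDist_convexComb_le`** — `‖Σ_k c_k μ_k − π‖ ≤ Σ_k c_k‖μ_k − π‖` (`c ≥ 0`, `Σ c = 1`);
  **`worstTvDist_lazyVersion_le_of_geometric`** — `d(j) ≤ Cλʲ (j ≤ n)` ⇒ `d^{lazy}(n) ≤ C((1+λ)/2)ⁿ`.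
* §2 **`lazyIdealStar_worstTvDist_le`** — `d^{lazy}(n) ≤ (K+1)·(1 − t(1−t)c/(4m))ⁿ/t`;
  **`lazyIdealStar_worstTvDist_le_of_ge_log`**, **`lazyIdealStar_mixingTime_le`** —
  `t_mix^{lazy}(ε) ≤ ⌈(4m/(t(1−t)c))·log((K+1)/(tε))⌉`.
* §3 **`lazyIdealStar_mixingTime_two_sided`** — with `Scaling/LazyHubWindow`'s floor (`θ_Σ = t` here):
  `(2K/t − 1)·log(K/4) ≤ t_mix^{lazy}(1/4) ≤ ⌈(4m/(t(1−t)c))·log((K+1)/(t/4))⌉`; **`_of_card`** supplies the rare start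
  when `|S| ≥ 4K`.

NOT CLAIMED: a lazy ceiling for general level laws (that is K6's spectral bound); cutoff.
Literature grade (cell rule): OWN COMPOSITION on PROVEN imports (`lawAt_lazyVersion_eq_binomial_sum` is
[cite: LevinPeres2017, Proposition 5.7 proof]); no new bib keys.
-/

noncomputable section

open Finset Function
open Literature.Probability.MarkovChains

namespace Summit.Ventures.LatticeQCDFlow.Scaling

/-! ## §1 Convexity of total variation and the binomial transfer to the lazy chain -/

section Generic
variable {X : Type*} [Fintype X] [DecidableEq X]

omit [DecidableEq X] in
/-- **Total variation is convex in its first argument:** `‖Σ_k c_k μ_k − π‖_TV ≤ Σ_k c_k ‖μ_k − π‖_TV` for weights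
`c ≥ 0` with `Σ_k c_k = 1`. [ours] -/
theorem tvDist_convexComb_le {ι : Type*} (s : Finset ι) {c : ι → ℝ} (hc0 : ∀ k ∈ s, 0 ≤ c k)
    (hc1 : ∑ k ∈ s, c k = 1) (μ : ι → X → ℝ) (π : X → ℝ) :
    tvDist (fun y => ∑ k ∈ s, c k * μ k y) π ≤ ∑ k ∈ s, c k * tvDist (μ k) π := by
  unfold tvDist
  calc 1 / 2 * ∑ y, |∑ k ∈ s, c k * μ k y - π y| ≤ 1 / 2 * ∑ y, ∑ k ∈ s, c k * |μ k y - π y| := by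
        gcongr with y hy
        calc |∑ k ∈ s, c k * μ k y - π y| = |∑ k ∈ s, c k * (μ k y - π y)| := by
              congr 1
              simp_rw [mul_sub]
              rw [Finset.sum_sub_distrib, ← Finset.sum_mul, hc1, one_mul]
          _ ≤ ∑ k ∈ s, |c k * (μ k y - π y)| := abs_sum_le_sum_abs _ _
          _ = ∑ k ∈ s, c k * |μ k y - π y| :=
              sum_congr rfl fun k hk => by rw [abs_mul, abs_of_nonneg (hc0 k hk)]
    _ = ∑ k ∈ s, c k * (1 / 2 * ∑ y, |μ k y - π y|) := by
        rw [Finset.sum_comm, Finset.mul_sum]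
        exact sum_congr rfl fun k _ => by rw [← Finset.mul_sum]; ring

/-- **Geometric ceilings transfer to the lazy chain at half the rate:** if `d(j) ≤ C·λʲ` for all `j ≤ n` (`λ ≥ 0`) then
`d^{lazy}(n) ≤ C·((1+λ)/2)ⁿ` — the lazy law is the binomial mixture of the plain laws and `‖·−π‖_TV` is convex. [ours] -/
theorem worstTvDist_lazyVersion_le_of_geometric (P : X → X → ℝ) (π : X → ℝ) {C lam : ℝ} (hlam : 0 ≤ lam) {n : ℕ}
    (hb : ∀ j ≤ n, worstTvDist P π j ≤ C * lam ^ j) :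
    worstTvDist (lazyVersion P) π n ≤ C * ((1 + lam) / 2) ^ n := by
  have hC : 0 ≤ C := by
    have h := (worstTvDist_nonneg P π 0).trans (hb 0 (Nat.zero_le _))
    simpa using h
  refine Real.iSup_le (fun x => ?_) (by positivity)
  rw [lawAt_lazyVersion_eq_binomial_sum]
  have hw0 : ∀ k ∈ range (n + 1), (0 : ℝ) ≤ (n.choose k : ℝ) / 2 ^ n := fun k _ => by positivity
  have hw1 : ∑ k ∈ range (n + 1), (n.choose k : ℝ) / 2 ^ n = 1 := by
    rw [← Finset.sum_div, div_eq_one_iff_eq (by positivity)]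
    exact_mod_cast Nat.sum_range_choose n
  have hbinom : ∑ k ∈ range (n + 1), (n.choose k : ℝ) * lam ^ k = (1 + lam) ^ n := by
    rw [add_comm (1 : ℝ) lam, add_pow]
    exact sum_congr rfl fun k _ => by rw [one_pow]; ring
  calc tvDist (fun y => ∑ k ∈ range (n + 1), (n.choose k : ℝ) / 2 ^ n * lawAt P (Pi.single x 1) k y) π
      ≤ ∑ k ∈ range (n + 1), (n.choose k : ℝ) / 2 ^ n * tvDist (lawAt P (Pi.single x 1) k) π :=
        tvDist_convexComb_le (range (n + 1)) hw0 hw1 (fun k => lawAt P (Pi.single x 1) k) π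
    _ ≤ ∑ k ∈ range (n + 1), (n.choose k : ℝ) / 2 ^ n * (C * lam ^ k) := by
        refine sum_le_sum fun k hk => mul_le_mul_of_nonneg_left ?_ (hw0 k hk)
        exact (tvDist_single_le_worstTvDist P π k x).trans (hb k (Nat.lt_succ_iff.mp (mem_range.mp hk)))
    _ = C / 2 ^ n * ∑ k ∈ range (n + 1), (n.choose k : ℝ) * lam ^ k := by
        rw [Finset.mul_sum]
        exact sum_congr rfl fun k _ => by ring
    _ = C * ((1 + lam) / 2) ^ n := by rw [hbinom, div_pow]; ring

end Generic

variable {S : Type*} [Fintype S] [DecidableEq S]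

/-! ## §2 The lazy idealised star: `d^{lazy}(n) ≤ (K+1)·(1 − t(1−t)c/(4m))ⁿ/t` -/

section LazyIdeal
variable {K m : ℕ} {ν : S → ℝ} {M : Fin (K + 1) → S → S → ℝ} {t : ℝ} (κ : Fin m → Fin K)

/-- **THE LAZY FRESHNESS CEILING: `d^{lazy}(n) ≤ (K+1)·(1 − t(1−t)c/(4m))ⁿ/t`** for the lazy version of the idealised
hot-only hub. [ours] -/
theorem lazyIdealStar_worstTvDist_le (hm : 1 ≤ m) (ht0 : 0 < t) (ht1 : t < 1) (hν : ∀ v, 0 < ν v) (hν1 : ∑ v, ν v = 1)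
    (hM : ∀ k, IsRowStochastic (M k)) (hM0 : ∀ u v, M 0 u v = ν v) {c : ℕ} (hc1 : 1 ≤ c)
    (hc : ∀ p : Fin K, c ≤ (univ.filter (fun r : Fin m => κ r = p)).card) (hcm : c ≤ m) (n : ℕ) :
    worstTvDist (lazyVersion (fun y z : Fin (K + 1) → S => t * ptGraphSwap (fun _ : Fin (K + 1) => ν)
          (fun r : Fin m => (((0 : Fin (K + 1)), (κ r).succ) : Fin (K + 1) × Fin (K + 1))) (fun _ => Equiv.refl S) y z
          + (1 - t) * prodKernel (fun k : Fin (K + 1) => if k = 0 then (1 : ℝ) else 0) M y z))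
        (tensorFun (fun _ : Fin (K + 1) => ν)) n
      ≤ ((K : ℝ) + 1) / t * (1 - t * (1 - t) * c / (4 * m)) ^ n := by
  have hmpos : (0 : ℝ) < m := Nat.cast_pos.mpr (by omega)
  have hcpos : (0 : ℝ) < c := Nat.cast_pos.mpr (by omega)
  have hcm' : (c : ℝ) ≤ m := by exact_mod_cast hcm
  have hlam : (0 : ℝ) ≤ 1 - t * (1 - t) * c / (2 * m) := by
    rw [sub_nonneg, div_le_one (by positivity)]
    have h1 : t * (1 - t) ≤ 1 := by nlinarith
    have h2 : t * (1 - t) * c ≤ 1 * c := mul_le_mul_of_nonneg_right h1 hcpos.le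
    linarith
  have h := worstTvDist_lazyVersion_le_of_geometric (fun y z : Fin (K + 1) → S =>
      t * ptGraphSwap (fun _ : Fin (K + 1) => ν)
        (fun r : Fin m => (((0 : Fin (K + 1)), (κ r).succ) : Fin (K + 1) × Fin (K + 1))) (fun _ => Equiv.refl S) y z
        + (1 - t) * prodKernel (fun k : Fin (K + 1) => if k = 0 then (1 : ℝ) else 0) M y z)
    (tensorFun (fun _ : Fin (K + 1) => ν)) (C := ((K : ℝ) + 1) / t) hlam (n := n)
    (fun j _ => by
      have hj := idealStar_worstTvDist_le κ hm ht0 ht1 hν hν1 hM hM0 hc1 hc hcm j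
      calc _ ≤ ((K : ℝ) + 1) * (1 - t * (1 - t) * c / (2 * m)) ^ j / t := hj
        _ = ((K : ℝ) + 1) / t * (1 - t * (1 - t) * c / (2 * m)) ^ j := by ring)
  have e : (1 + (1 - t * (1 - t) * c / (2 * m))) / 2 = 1 - t * (1 - t) * c / (4 * m) := by
    field_simp
    ring
  rwa [e] at h

/-- **`d^{lazy}(n) ≤ ε` once `n ≥ (4m/(t(1−t)c))·log((K+1)/(tε))`.** [ours] -/
theorem lazyIdealStar_worstTvDist_le_of_ge_log (hm : 1 ≤ m) (ht0 : 0 < t) (ht1 : t < 1) (hν : ∀ v, 0 < ν v)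
    (hν1 : ∑ v, ν v = 1) (hM : ∀ k, IsRowStochastic (M k)) (hM0 : ∀ u v, M 0 u v = ν v) {c : ℕ} (hc1 : 1 ≤ c)
    (hc : ∀ p : Fin K, c ≤ (univ.filter (fun r : Fin m => κ r = p)).card) (hcm : c ≤ m) {ε : ℝ} (hε : 0 < ε) {n : ℕ}
    (hn : 4 * (m : ℝ) / (t * (1 - t) * c) * Real.log (((K : ℝ) + 1) / (t * ε)) ≤ n) :
    worstTvDist (lazyVersion (fun y z : Fin (K + 1) → S => t * ptGraphSwap (fun _ : Fin (K + 1) => ν)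
          (fun r : Fin m => (((0 : Fin (K + 1)), (κ r).succ) : Fin (K + 1) × Fin (K + 1))) (fun _ => Equiv.refl S) y z
          + (1 - t) * prodKernel (fun k : Fin (K + 1) => if k = 0 then (1 : ℝ) else 0) M y z))
        (tensorFun (fun _ : Fin (K + 1) => ν)) n ≤ ε := by
  have hmpos : (0 : ℝ) < m := Nat.cast_pos.mpr (by omega)
  have hcpos : (0 : ℝ) < c := Nat.cast_pos.mpr (by omega)
  have hcm' : (c : ℝ) ≤ m := by exact_mod_cast hcm
  have hK1 : (0 : ℝ) < (K : ℝ) + 1 := by positivity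
  set a := t * (1 - t) * c / (4 * m) with ha
  have hapos : 0 < a := by rw [ha]; exact div_pos (mul_pos (mul_pos ht0 (by linarith)) hcpos) (by positivity)
  have hale : a ≤ 1 := by
    rw [ha, div_le_one (by positivity)]
    have h1 : t * (1 - t) ≤ 1 := by nlinarith
    have h2 : t * (1 - t) * c ≤ 1 * c := mul_le_mul_of_nonneg_right h1 hcpos.le
    linarith
  refine (lazyIdealStar_worstTvDist_le κ hm ht0 ht1 hν hν1 hM hM0 hc1 hc hcm n).trans ?_
  have hna : Real.log (((K : ℝ) + 1) / (t * ε)) ≤ n * a := by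
    have h := mul_le_mul_of_nonneg_right hn hapos.le
    have h1t : (1 : ℝ) - t ≠ 0 := (sub_pos.mpr ht1).ne'
    have e : 4 * (m : ℝ) / (t * (1 - t) * c) * Real.log (((K : ℝ) + 1) / (t * ε)) * a
        = Real.log (((K : ℝ) + 1) / (t * ε)) := by
      rw [ha]; field_simp
    linarith [e]
  have hpow : (1 - a) ^ n ≤ Real.exp (-(n * a)) := by
    calc (1 - a) ^ n ≤ (Real.exp (-a)) ^ n := by
          apply pow_le_pow_left₀ (by linarith)
          have := Real.add_one_le_exp (-a); linarith
      _ = Real.exp (-(n * a)) := by rw [← Real.exp_nat_mul]; ring_nf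
  have hexp : Real.exp (-(n * a)) ≤ t * ε / ((K : ℝ) + 1) := by
    calc Real.exp (-(n * a)) ≤ Real.exp (-Real.log (((K : ℝ) + 1) / (t * ε))) := Real.exp_le_exp.mpr (by linarith)
      _ = t * ε / ((K : ℝ) + 1) := by rw [Real.exp_neg, Real.exp_log (by positivity), inv_div]
  calc ((K : ℝ) + 1) / t * (1 - a) ^ n ≤ ((K : ℝ) + 1) / t * (t * ε / ((K : ℝ) + 1)) := by
        gcongr
        exact hpow.trans hexp
    _ = ε := by field_simp

/-- **THE LAZY CEILING: `t_mix^{lazy}(ε) ≤ ⌈(4m/(t(1−t)c))·log((K+1)/(tε))⌉`.** [ours] -/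
theorem lazyIdealStar_mixingTime_le (hm : 1 ≤ m) (ht0 : 0 < t) (ht1 : t < 1) (hν : ∀ v, 0 < ν v) (hν1 : ∑ v, ν v = 1)
    (hM : ∀ k, IsRowStochastic (M k)) (hM0 : ∀ u v, M 0 u v = ν v) {c : ℕ} (hc1 : 1 ≤ c)
    (hc : ∀ p : Fin K, c ≤ (univ.filter (fun r : Fin m => κ r = p)).card) (hcm : c ≤ m) {ε : ℝ} (hε : 0 < ε) :
    mixingTime (lazyVersion (fun y z : Fin (K + 1) → S => t * ptGraphSwap (fun _ : Fin (K + 1) => ν)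
          (fun r : Fin m => (((0 : Fin (K + 1)), (κ r).succ) : Fin (K + 1) × Fin (K + 1))) (fun _ => Equiv.refl S) y z
          + (1 - t) * prodKernel (fun k : Fin (K + 1) => if k = 0 then (1 : ℝ) else 0) M y z))
        (tensorFun (fun _ : Fin (K + 1) => ν)) ε
      ≤ ⌈4 * (m : ℝ) / (t * (1 - t) * c) * Real.log (((K : ℝ) + 1) / (t * ε))⌉₊ :=
  mixingTime_le _ _ (lazyIdealStar_worstTvDist_le_of_ge_log κ hm ht0 ht1 hν hν1 hM hM0 hc1 hc hcm hε (Nat.le_ceil _))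

/-! ## §3 The lazy `K·log K` law on both sides -/

/-- **THE LAZY `K·log K` LAW, BOTH SIDES (`K ≥ 1`):** idealised hot-only hub, `ν`-reversible row-stochastic cold kernels,
every hub edge listed `≥ c ≥ 1` times, a configuration `x` with `Σ_k ν(x_{k+1}) ≤ 1/4`:
**`(2K/t − 1)·log(K/4) ≤ t_mix^{lazy}(1/4) ≤ ⌈(4m/(t(1−t)c))·log((K+1)/(t/4))⌉`** — the window of `Scaling/LazyHubWindow`
closes to the constant `≈ 2/(1−t)·(m/(cK))` in the idealised case. [ours] -/
theorem lazyIdealStar_mixingTime_two_sided (hK : 1 ≤ K) (hm : 1 ≤ m) (ht0 : 0 < t) (ht1 : t < 1) (hν : ∀ v, 0 < ν v)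
    (hν1 : ∑ v, ν v = 1) (hM : ∀ k, IsRowStochastic (M k)) (hMrev : ∀ k, DetailedBalance ν (M k))
    (hM0 : ∀ u v, M 0 u v = ν v) {c : ℕ} (hc1 : 1 ≤ c) (hc : ∀ p : Fin K, c ≤ (univ.filter (fun r : Fin m => κ r = p)).card)
    (hcm : c ≤ m) (x : Fin (K + 1) → S) (hx : ∑ k : Fin K, ν (x k.succ) ≤ 1 / 4) :
    (2 * (K : ℝ) / t - 1) * Real.log (K / 4)
        ≤ (mixingTime (lazyVersion (fun y z : Fin (K + 1) → S => t * ptGraphSwap (fun _ : Fin (K + 1) => ν)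
            (fun r : Fin m => (((0 : Fin (K + 1)), (κ r).succ) : Fin (K + 1) × Fin (K + 1))) (fun _ => Equiv.refl S) y z
            + (1 - t) * prodKernel (fun k : Fin (K + 1) => if k = 0 then (1 : ℝ) else 0) M y z))
          (tensorFun (fun _ : Fin (K + 1) => ν)) (1 / 4) : ℝ) ∧
      mixingTime (lazyVersion (fun y z : Fin (K + 1) → S => t * ptGraphSwap (fun _ : Fin (K + 1) => ν)
            (fun r : Fin m => (((0 : Fin (K + 1)), (κ r).succ) : Fin (K + 1) × Fin (K + 1))) (fun _ => Equiv.refl S) y z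
            + (1 - t) * prodKernel (fun k : Fin (K + 1) => if k = 0 then (1 : ℝ) else 0) M y z))
          (tensorFun (fun _ : Fin (K + 1) => ν)) (1 / 4)
        ≤ ⌈4 * (m : ℝ) / (t * (1 - t) * c) * Real.log (((K : ℝ) + 1) / (t * (1 / 4)))⌉₊ := by
  refine ⟨?_, lazyIdealStar_mixingTime_le κ hm ht0 ht1 hν hν1 hM hM0 hc1 hc hcm (by norm_num)⟩
  have hmix : ∃ t₀, worstTvDist (lazyVersion (fun y z : Fin (K + 1) → S => t * ptGraphSwap (fun _ : Fin (K + 1) => ν)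
      (fun r : Fin m => (((0 : Fin (K + 1)), (κ r).succ) : Fin (K + 1) × Fin (K + 1))) (fun _ => Equiv.refl S) y z
      + (1 - t) * prodKernel (fun k : Fin (K + 1) => if k = 0 then (1 : ℝ) else 0) M y z))
      (tensorFun (fun _ : Fin (K + 1) => ν)) t₀ ≤ 1 / 4 :=
    ⟨_, lazyIdealStar_worstTvDist_le_of_ge_log κ hm ht0 ht1 hν hν1 hM hM0 hc1 hc hcm (by norm_num : (0:ℝ) < 1 / 4)
      (Nat.le_ceil _)⟩
  have h := lazyHub_mixingTime_ge_quarter κ (fun _ => Equiv.refl S) hK hm (μ := fun _ : Fin (K + 1) => ν)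
    (fun _ v => hν v) (fun _ => hν1) hM (fun k => hMrev k) (w := fun k : Fin (K + 1) => if k = 0 then (1 : ℝ) else 0)
    (fun k => by positivity) (by rw [Fintype.sum_ite_eq']) ht0.le ht1.le (by simp [ht0]) x hx hmix
  simpa using h

/-- **THE LAZY `K·log K` LAW ON A LARGE CONFIGURATION SPACE (`|S| ≥ 4K`):** the same with the rare start supplied. [ours] -/
theorem lazyIdealStar_mixingTime_two_sided_of_card (hK : 1 ≤ K) (hS : 4 * K ≤ Fintype.card S) (hm : 1 ≤ m)
    (ht0 : 0 < t) (ht1 : t < 1) (hν : ∀ v, 0 < ν v) (hν1 : ∑ v, ν v = 1) (hM : ∀ k, IsRowStochastic (M k))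
    (hMrev : ∀ k, DetailedBalance ν (M k)) (hM0 : ∀ u v, M 0 u v = ν v) {c : ℕ} (hc1 : 1 ≤ c)
    (hc : ∀ p : Fin K, c ≤ (univ.filter (fun r : Fin m => κ r = p)).card) (hcm : c ≤ m) :
    (2 * (K : ℝ) / t - 1) * Real.log (K / 4)
        ≤ (mixingTime (lazyVersion (fun y z : Fin (K + 1) → S => t * ptGraphSwap (fun _ : Fin (K + 1) => ν)
            (fun r : Fin m => (((0 : Fin (K + 1)), (κ r).succ) : Fin (K + 1) × Fin (K + 1))) (fun _ => Equiv.refl S) y z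
            + (1 - t) * prodKernel (fun k : Fin (K + 1) => if k = 0 then (1 : ℝ) else 0) M y z))
          (tensorFun (fun _ : Fin (K + 1) => ν)) (1 / 4) : ℝ) ∧
      mixingTime (lazyVersion (fun y z : Fin (K + 1) → S => t * ptGraphSwap (fun _ : Fin (K + 1) => ν)
            (fun r : Fin m => (((0 : Fin (K + 1)), (κ r).succ) : Fin (K + 1) × Fin (K + 1))) (fun _ => Equiv.refl S) y z
            + (1 - t) * prodKernel (fun k : Fin (K + 1) => if k = 0 then (1 : ℝ) else 0) M y z))
          (tensorFun (fun _ : Fin (K + 1) => ν)) (1 / 4)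
        ≤ ⌈4 * (m : ℝ) / (t * (1 - t) * c) * Real.log (((K : ℝ) + 1) / (t * (1 / 4)))⌉₊ := by
  obtain ⟨x, hx⟩ := exists_rare_coldStart (μ := fun _ : Fin (K + 1) => ν) (fun _ => hν1) hS
  exact lazyIdealStar_mixingTime_two_sided κ hK hm ht0 ht1 hν hν1 hM hMrev hM0 hc1 hc hcm x hx

end LazyIdeal

end Summit.Ventures.LatticeQCDFlow.Scaling

end
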